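import Literature.MathematicalPhysics.QuantumFieldTheory.Balaban1983to89.B8Eq1101CubeMemberRealM4
import Literature.MathematicalPhysics.QuantumFieldTheory.Balaban1983to89.B8Eq198CubeMemberOfReal12
import Literature.MathematicalPhysics.QuantumFieldTheory.Balaban1983to89.B8Eq192CubeMemberOfReal1G

/-!
# `Balaban1983to89.B8Prop6CubeMemberRealOfGBound` — [Balaban1985RegularSpaces] the THREE REAL FAMILIES ((1.101), (1.92)+Δ, (1.98)) of the p6 flat consumer
# `B8Prop6CubeMemberFlatScalar.prop6_cubeMember_flat_of_real` FROM ONE HYPOTHESIS: the 𝒢-bound for `𝒢 = (QT⁻²Qᵀ)⁻¹` ([Balaban1985BackgroundPropagators] Theorem 3.2 (3.48))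
# — printed weights, print's big-block sub-lattice of data; assembly of F4d∕F4e (REAL-1), F7 (REAL-1′), F6 (REAL-2 reduction), F5 (REAL-3 reduction)

statement-level skeleton of published theorems with citation tags; proofs where landed; nothing here is a claim about the
Yang–Mills mass gap

`[Balaban1985RegularSpaces]` ("B8", CMP **99** (1985) 75–102) (1.91)–(1.92) p. 91, (1.98) p. 92, (1.101) p. 93, p. 98, (1.131) p. 99; `[Balaban1985BackgroundPropagators]`
("[4]") Theorems 3.1–3.2, (3.47)–(3.48) p. 398, (3.25) p. 394.

CITATION HEADER (lean-in-tree rule).  Cell `pub-ymgap` (YM Track A, HUMAN RULING D-0062), DAG node N05 = [B8], seat `pub-ymgap-dag-n05-c` (g9; (R1′) programme, file F8 =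
the programme's one-statement summary).  The consumer displays three real inequality families on its explicit matrices as hypotheses.  Files F1–F7 of this seat
proved REAL-1 ((1.101) at exponent −2 → 0, both members) and REAL-1′ (exponent −4 → −2, function member) on print's big-block sub-lattice at the printed weights,
and reduced REAL-3 to REAL-1 + REAL-2 and REAL-2 to REAL-1 + REAL-1′ + the 𝒢-bound.  THIS FILE composes them: GIVEN the 𝒢-bound (the one open estimate,
[4] Theorem 3.2 ⇔ [B6] Prop. 2.3 for the glued operator), all three families hold verbatim.

WHAT THIS FILE PROVES (kernel-checked; one theorem).
* ★★★ `prop6_real123_of_gbound_printed` — ∃ `B_G, B_G′, ρ₀, M₀ > 0`, `N₀ ≥ 1` (depending on `d, ℓ`): for `η > 0`, `M_h ≥ 3`, `M₀ ≤ L·M_h`, cube data with `M_hL ∣ ρ, M`,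
  `R·M_hL ≤ ρ`, `2L ≤ R`, `N₀ + 1 ≤ R·L·M_h`, `ρ₀ ≤ ρ`, truncation `1 ≤ n ≤ k`, the consumer's `S, B, K` (at `w = wPrinted d ℓ η`), `T, Q`, and ANY `C_𝒢 ≥ 0` with the
  𝒢-bound: REAL-1 (constant `B_G`) ∧ REAL-2 (`B₀′_H = B_G(B_G′C_𝒢)`, `B₂′ = B_G′C_𝒢 + 8`) ∧ REAL-3 (`B_R = 1 + (B_G′C_𝒢 + 16)B_G`), each in the consumer's VERBATIM shape
  (with `L = ℓ + 1`, dimension `d + 1`).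

HONEST SCOPE ∕ NOT CLAIMED.  The 𝒢-bound is a HYPOTHESIS (open; design `HOME/pub-ymgap-dag-n05-c/R23-DESIGN.md`); the data live on print's big-block sub-lattice
(non-empty for all thresholds: `B8Eq1101CubeMemberWeights.admissibleData_exists`), whereas the consumer quantifies over all `L ≤ ρ ≤ M` — the knit is n05-e's.
Count-neutral; N05 NOT discharged; one finite `T⁴` programme at fixed `ε`, Bałaban as printed; nothing continuum ∕ ℝ⁴ ∕ OS ∕ mass-gap ∕ Clay.  No `sorry`, no `def`,
no `instance`, no `notation`.  Unit `pub-ymgap-dag-n05-c` (g9), 2026-08-27.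

RELATED IN THE TREE, NOT DUPLICATED (all USED by name): `B8Eq1101CubeMemberWeights.ineq1101_cubeMember_real_printed` (REAL-1), `B8Eq1101CubeMemberRealM4.
ineq1101_cubeMember_m4_printed` (REAL-1′), `B8Eq192CubeMemberOfReal1G.real2_of_real1_gbound`, `B8Eq198CubeMemberOfReal12.real3_of_real1_real2`; the consumer
`B8Prop6CubeMemberFlatScalar.prop6_cubeMember_flat_of_real` (n05-e; its three real blocks are reproduced verbatim as the conclusion).
-/
noncomputable section

namespace Literature.MathematicalPhysics.QuantumFieldTheory.Balaban1983to89.B8Prop6CubeMemberRealOfGBound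

open scoped Matrix
open B7Prop1Explicit (e)
open B8Eq131CubesAdmissible (cubeFam)
open B8Eq140Level (SideTouches)
open B8CubeMemberZd (cubeLamS)
open B8LambdaSpaceKLevel (wt)
open B8Eq1101CubeMemberWeights (awPrinted wPrinted awPrinted_facts wPrinted_facts)
open B8Eq1101CubeMemberRealGrad (ineq1101_cubeMember_real)
open B8Eq1101CubeMemberWeights (ineq1101_cubeMember_real_printed)
open B8Eq1101CubeMemberRealM4 (ineq1101_cubeMember_m4_printed)
open B8Eq198CubeMemberOfReal12 (real3_of_real1_real2)
open B8Eq192CubeMemberOfReal1G (real2_of_real1_gbound)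
open Literature.MathematicalPhysics.QuantumLattice (blockMap)

open Classical in
/-- **THE THREE REAL FAMILIES OF `B8Prop6CubeMemberFlatScalar.prop6_cubeMember_flat_of_real` FROM THE 𝒢-BOUND ALONE** (printed weights `wPrinted`, print's
big-block sub-lattice of data).  There are `B_G, B_G′, ρ₀, M₀ > 0`, `N₀ ≥ 1` (depending on `d, ℓ`) such that for every `η > 0`, every big-block size `M_h ≥ 3` with
`M₀ ≤ L·M_h` (`L = ℓ + 1`), every cube datum and truncation `1 ≤ n ≤ k` with `M_hL ∣ ρ`, `M_hL ∣ M`, `R·M_hL ≤ ρ`, `2L ≤ R`, `N₀ + 1 ≤ R·L·M_h`, `ρ₀ ≤ ρ`, the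
consumer's explicit `S`, `B`, `K` (at `w = wPrinted`), `T`, `Q`, and every constant `C_𝒢 ≥ 0` for which the 𝒢-BOUND holds
(`sup|X| ≤ s ⟹ wt(j_p)⁴L^{−(d+1)j_p}|((QT⁻¹T⁻¹Qᵀ)⁻¹X)_p| ≤ C_𝒢 s`, [4] Theorem 3.2 (3.48)): REAL-1 ((1.101), constant `B_G`), REAL-2 ((1.92) + Δ-entry, constants
`B₀′_H = B_G(B_G′C_𝒢)`, `B₂′ = B_G′C_𝒢 + 8`) and REAL-3 ((1.98), constant `B_R = 1 + (B_G′C_𝒢 + 16)B_G`) hold in the consumer's VERBATIM shapes.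
Assembly of F4d∕F4e (REAL-1), F7 (REAL-1′), F6 (REAL-2 ⟸ REAL-1 + REAL-1′ + 𝒢-bound), F5 (REAL-3 ⟸ REAL-1 + REAL-2); nothing else.
[cite: Balaban1985RegularSpaces, (1.91)–(1.92) p.91, (1.98) p.92, (1.101) p.93, p.98, (1.131) p.99; Balaban1985BackgroundPropagators, Theorems 3.1–3.2 (3.47)–(3.48) p.398, (3.25) p.394] -/
theorem prop6_real123_of_gbound_printed (d ℓ : ℕ) (hℓ : 1 ≤ ℓ) :
    ∃ BG BG' ρ₀ M₀ : ℝ, ∃ N₀ : ℕ, 0 < BG ∧ 0 < BG' ∧ 0 < M₀ ∧ 0 < N₀ ∧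
      ∀ (η : ℝ), 0 < η → ∀ (Mh : ℕ), 3 ≤ Mh → M₀ ≤ ((ℓ : ℝ) + 1) * Mh →
      ∀ (a : Fin (d + 1) → ℤ) (M ρ k n R : ℕ), 1 ≤ n → n ≤ k → Mh * (ℓ + 1) ∣ ρ → Mh * (ℓ + 1) ∣ M → 0 < ρ →
        R * (Mh * (ℓ + 1)) ≤ ρ → 2 * (ℓ + 1) ≤ R → N₀ + 1 ≤ R * ((ℓ + 1) * Mh) → ρ₀ ≤ (ρ : ℝ) →
      ∀ (S : Finset (Fin (d + 1) → ℤ)), (∀ z, z ∈ S ↔ z ∈ cubeFam false (ℓ + 1) a M ρ k 0) →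
      ∀ (B : Finset (ℕ × (Fin (d + 1) → ℤ))), (∀ p, p ∈ B ↔ p.1 ≤ n ∧ p.2 ∈ cubeLamS (ℓ + 1) a M ρ k n p.1) →
      ∀ (K : (Fin (d + 1) → ℤ) → (Fin (d + 1) → ℤ) → ℝ), (∀ x z, K x z =
          ((η ^ 2)⁻¹ * ∑ μ : Fin (d + 1), ((2 : ℝ) * (if z = x then (1 : ℝ) else 0) - (if z = x + e μ then (1 : ℝ) else 0)
            - (if z = x - e μ then (1 : ℝ) else 0))) +
          (∑ j ∈ Finset.range (n + 1), (if blockMap ((ℓ + 1) ^ j) x ∈ cubeLamS (ℓ + 1) a M ρ k n j ∧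
              blockMap ((ℓ + 1) ^ j) z = blockMap ((ℓ + 1) ^ j) x then
            wPrinted d ℓ η j * (((((ℓ + 1 : ℕ) : ℝ) ^ (d + 1))⁻¹) ^ j) ^ 2 else 0))) →
      ∀ (T : Matrix ↥S ↥S ℝ), T = Matrix.of (fun x z : ↥S => K x.1 z.1) →
      ∀ (Q : Matrix ↥B ↥S ℝ), Q = Matrix.of (fun (p : ↥B) (z : ↥S) =>
          if blockMap ((ℓ + 1) ^ p.1.1) z.1 = p.1.2 then (((((ℓ + 1 : ℕ) : ℝ)) ^ (d + 1))⁻¹) ^ p.1.1 else 0) →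
      ∀ (CG : ℝ), 0 ≤ CG →
      -- the 𝒢-bound ([4] Theorem 3.2 (3.48), row-summed, consumer's normalisation) — THE HYPOTHESIS
      (∀ (X : ↥B → ℝ) (s : ℝ), 0 ≤ s → (∀ p', |X p'| ≤ s) → ∀ p : ↥B,
        wt (ℓ + 1) η p.1.1 ^ 4 * (((((ℓ + 1 : ℕ) : ℝ)) ^ (d + 1)) ^ p.1.1)⁻¹ * |∑ p' : ↥B, (Q * T⁻¹ * T⁻¹ * Qᵀ)⁻¹ p p' * X p'| ≤ CG * s) →
      -- REAL-1: (1.101) for `T⁻¹`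
      (∀ (ρ' : ↥S → ℝ) (r : ℝ), 0 ≤ r →
        (∀ j, j ≤ n → ∀ z : ↥S, z.1 ∈ cubeFam false (ℓ + 1) a M ρ k j → wt (ℓ + 1) η j ^ 2 * |ρ' z| ≤ r) →
        ∀ φ : (Fin (d + 1) → ℤ) → ℝ, (∀ x, x ∉ cubeFam false (ℓ + 1) a M ρ k 0 → φ x = 0) →
          (∀ v : ↥S, φ v.1 = ∑ z : ↥S, T⁻¹ v z * ρ' z) →
          (∀ x, |φ x| ≤ BG * r) ∧
          ∀ j, j ≤ n → ∀ p ∈ {b : (Fin (d + 1) → ℤ) × Fin (d + 1) | SideTouches (cubeFam false (ℓ + 1) a M ρ k j) b.1 b.2},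
            wt (ℓ + 1) η j * |η⁻¹ * (φ (p.1 + e p.2) - φ p.1)| ≤ BG * r) ∧
      -- REAL-2: (1.92) and the Δ-entry for `H′ = T⁻¹(T⁻¹Qᵀ)(QT⁻²Qᵀ)⁻¹`
      (∀ (X : ↥B → ℝ) (s : ℝ), 0 ≤ s → (∀ p', |X p'| ≤ s) →
        ∀ φ : (Fin (d + 1) → ℤ) → ℝ, (∀ x, x ∉ cubeFam false (ℓ + 1) a M ρ k 0 → φ x = 0) →
          (∀ v : ↥S, φ v.1 = ∑ p' : ↥B, (T⁻¹ * (T⁻¹ * Qᵀ) * (Q * T⁻¹ * T⁻¹ * Qᵀ)⁻¹) v p' * X p') →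
          (∀ x, |φ x| ≤ BG * (BG' * CG) * s) ∧
          (∀ j, j ≤ n → ∀ p ∈ {b : (Fin (d + 1) → ℤ) × Fin (d + 1) | SideTouches (cubeFam false (ℓ + 1) a M ρ k j) b.1 b.2},
            wt (ℓ + 1) η j * |η⁻¹ * (φ (p.1 + e p.2) - φ p.1)| ≤ BG * (BG' * CG) * s) ∧
          (∀ j, j ≤ n → ∀ x ∈ cubeFam false (ℓ + 1) a M ρ k j,
            wt (ℓ + 1) η j ^ 2 * |∑ μ : Fin (d + 1), (η ^ 2)⁻¹ * (2 * φ x - φ (x + e μ) - φ (x - e μ))| ≤ (BG' * CG + 8) * s)) ∧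
      -- REAL-3: (1.98) for `1 − T⁻¹Qᵀ(QT⁻²Qᵀ)⁻¹QT⁻¹`
      (∀ (ρ' : ↥S → ℝ) (r : ℝ), 0 ≤ r →
        (∀ j, j ≤ n → ∀ z : ↥S, z.1 ∈ cubeFam false (ℓ + 1) a M ρ k j → wt (ℓ + 1) η j ^ 2 * |ρ' z| ≤ r) →
        ∀ j, j ≤ n → ∀ v : ↥S, v.1 ∈ cubeFam false (ℓ + 1) a M ρ k j →
          wt (ℓ + 1) η j ^ 2 * |ρ' v - ∑ z : ↥S, (T⁻¹ * (Qᵀ * ((Q * T⁻¹ * T⁻¹ * Qᵀ)⁻¹ * (Q * T⁻¹)))) v z * ρ' z|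
            ≤ (1 + ((BG' * CG + 8) + 8) * BG) * r) := by
  obtain ⟨BG, ρ₁, M₁, N₁, hBG, hM₁, hN₁, h1⟩ := ineq1101_cubeMember_real_printed d ℓ hℓ
  obtain ⟨BG', ρ₂, M₂, N₂, hBG', hM₂, hN₂, h2⟩ := ineq1101_cubeMember_m4_printed d ℓ hℓ
  refine ⟨BG, BG', max ρ₁ ρ₂, max M₁ M₂, max N₁ N₂, hBG, hBG', lt_max_of_lt_left hM₁, lt_max_of_lt_left hN₁, ?_⟩
  intro η hη Mh hMh hM0 a M ρ k n R hn hnk hρd hMd hρ0 hR hR2 hRN hρbig S hS B hB K hK T hT Q hQ CG hCG hG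
  have hL : 1 ≤ ℓ + 1 := Nat.succ_pos ℓ
  have hη0 : η ≠ 0 := hη.ne'
  have hMh1 : 1 ≤ Mh := le_trans (by norm_num) hMh
  have hρL : ℓ + 1 ≤ ρ := le_trans (Nat.le_mul_of_pos_left _ hMh1) (Nat.le_of_dvd hρ0 hρd)
  have hM01 : M₁ ≤ ((ℓ : ℝ) + 1) * Mh := (le_max_left _ _).trans hM0
  have hM02 : M₂ ≤ ((ℓ : ℝ) + 1) * Mh := (le_max_right _ _).trans hM0
  have hRN1 : N₁ + 1 ≤ R * ((ℓ + 1) * Mh) := le_trans (Nat.add_le_add_right (le_max_left _ _) 1) hRN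
  have hRN2 : N₂ + 1 ≤ R * ((ℓ + 1) * Mh) := le_trans (Nat.add_le_add_right (le_max_right _ _) 1) hRN
  have hρ1 : ρ₁ ≤ (ρ : ℝ) := (le_max_left _ _).trans hρbig
  have hρ2 : ρ₂ ≤ (ρ : ℝ) := (le_max_right _ _).trans hρbig
  -- REAL-1 (F4d ∕ F4e) and REAL-1′ (F7) at the printed weights
  have hR1 := h1 η hη Mh hMh hM01 a M ρ k n R hn hnk hρd hMd hρ0 hR hR2 hRN1 hρ1 S hS K hK T hT
  have hR1' := h2 η hη Mh hMh hM02 a M ρ k n R hn hnk hρd hMd hρ0 hR hR2 hRN2 hρ2 S hS K hK T hT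
  -- the weights: nonnegative, normalised size `≤ 8`
  obtain ⟨hwin, -, -, -⟩ := awPrinted_facts hℓ
  obtain ⟨hwpos, -, hwwin⟩ := wPrinted_facts d hℓ hη
  have hw0 : ∀ j, 0 ≤ wPrinted d ℓ η j := fun j => (hwpos j).le
  have hamax : ∀ j, j ≤ n → wPrinted d ℓ η j * η ^ 2 * ((((ℓ + 1 : ℕ) : ℝ)) ^ j) ^ 2 * (((((ℓ + 1 : ℕ) : ℝ)) ^ (d + 1)) ^ j)⁻¹ ≤ 8 := by
    intro j _
    rw [hwwin j]
    rcases Nat.eq_zero_or_pos j with h0 | hp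
    · subst h0; norm_num [awPrinted]
    · exact (hwin j hp).2
  -- REAL-2 from F6
  have hR2 : ∀ (X : ↥B → ℝ) (s : ℝ), 0 ≤ s → (∀ p', |X p'| ≤ s) →
      ∀ φ : (Fin (d + 1) → ℤ) → ℝ, (∀ x, x ∉ cubeFam false (ℓ + 1) a M ρ k 0 → φ x = 0) →
        (∀ v : ↥S, φ v.1 = ∑ p' : ↥B, (T⁻¹ * (T⁻¹ * Qᵀ) * (Q * T⁻¹ * T⁻¹ * Qᵀ)⁻¹) v p' * X p') →
        (∀ x, |φ x| ≤ BG * (BG' * CG) * s) ∧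
        (∀ j, j ≤ n → ∀ p ∈ {b : (Fin (d + 1) → ℤ) × Fin (d + 1) | SideTouches (cubeFam false (ℓ + 1) a M ρ k j) b.1 b.2},
          wt (ℓ + 1) η j * |η⁻¹ * (φ (p.1 + e p.2) - φ p.1)| ≤ BG * (BG' * CG) * s) ∧
        (∀ j, j ≤ n → ∀ x ∈ cubeFam false (ℓ + 1) a M ρ k j,
          wt (ℓ + 1) η j ^ 2 * |∑ μ : Fin (d + 1), (η ^ 2)⁻¹ * (2 * φ x - φ (x + e μ) - φ (x - e μ))| ≤ (BG' * CG + 8) * s) :=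
    fun X s hs hXs φ hφ0 hφS =>
      real2_of_real1_gbound hL a M hρL hnk hη0 (wPrinted d ℓ η) hw0 (by norm_num) hamax S hS B hB K hK T hT Q hQ hBG'.le hCG
        hR1 hR1' hG X s hs hXs φ hφ0 hφS
  refine ⟨hR1, hR2, ?_⟩
  -- REAL-3 from F5
  intro ρ' r hr hρ' j hj v hv
  exact real3_of_real1_real2 hL a M hρL hnk hη0 (wPrinted d ℓ η) hw0 (by norm_num) hamax S hS B hB K hK T hT Q hQ hBG.le
    (fun ρ' r hr hρ' φ hφ0 hφS => (hR1 ρ' r hr hρ' φ hφ0 hφS).1)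
    (fun X s hs hXs φ hφ0 hφS => ⟨(hR2 X s hs hXs φ hφ0 hφS).1, (hR2 X s hs hXs φ hφ0 hφS).2.2⟩)
    ρ' r hr hρ' j hj v hv

end Literature.MathematicalPhysics.QuantumFieldTheory.Balaban1983to89.B8Prop6CubeMemberRealOfGBound
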